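import Summits.HubbardSuperconductivity.HubbardSuperconductivity.Theses.LogColdTorus
import Summits.HubbardSuperconductivity.HubbardSuperconductivity.Theorems.LogColdTorusAverageToEveryStubBlockAverageWitness
import Summits.HubbardSuperconductivity.HubbardSuperconductivity.Theorems.LogColdTorusAverageToEveryTransfer
import Summits.HubbardSuperconductivity.HubbardSuperconductivity.Theorems.BalabanIRBirEveryGroundState
import HarnessLib

/-!
# Route `LogColdTorus`, crux `AverageToEvery` (item `stmt-HubbardSuperconductivity-10519`, shared with route
`AbelianDuality`): the slices `|δ| ≥ 1` of the crux, and the uniqueness template behind every proved slice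

Helpers (`--supports`) for the crux
`Summit.HubbardSuperconductivity.HubbardSuperconductivity.Theses.LogColdTorus.AverageToEvery`
(a law for EVERY real `δ`, filling `N_L = 2⌊(1-δ)L²/2⌋`), completing the calibration of the BET
`stub_countableAccidentalCouplings` of line `birth` begun in `LogColdTorusAverageToEveryHalfFilling.lean`
(`δ = 0`, Lieb's Theorem 2):

* `botOrTop_of_groundStates_smul` — TEMPLATE (any filling `N`, any coupling, any side): if any two
  `(N, S^z = 0)`-sector ground states of `hubbardTorus 2 L 1 U` are proportional, the sector ground
  eigenspace `E₀ = szSector N 0 ⊓ ker (H - e₀)` has no subspace other than `⊥` and itself (so it is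
  irreducible under ANY family of operators — the conclusion of the BET without exceptional set);
* `averageToEvery_pointwise_of_groundStates_smul` — TEMPLATE: at ONE coupling `U` and one `δ`, if
  sector ground states are eventually (in even `L`) unique up to scalars, the every-ground-state
  upgrade holds at `U`: an eventual block ground-state average `≥ c L⁴` of `Δ_d† Δ_d` forces
  `d_{x²-y²}` pair-field long-range order of EVERY admissible ground-state sequence (block ↔ Fock
  dictionary `stub_blockAverageWitness` + `hasLRO_of_forall_groundState_bound`);
* `groundStates_smul_of_one_le` (`δ ≥ 1`: `N_L = 0`, the sector is the vacuum ray),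
  `groundStates_smul_neg_one` (`δ = -1`: `N_L = 2L²`, the sector is the fully-occupied ray),
  `groundStates_smul_of_lt_neg_one` (`δ < -1`: no sector ground state from some side on,
  `not_isGroundStateInSector_of_lt_neg_one`) — eventual uniqueness up to scalars on `|δ| ≥ 1`, at
  EVERY real coupling;
* `irreducibleGround_of_one_le_abs` — hence the hypothesis-free irreducible-ground law HOLDS on
  `|δ| ≥ 1` at every coupling (template 1), and `stub_countableAccidentalCouplings_of_one_le_abs` — the
  registered BET restricted to `1 ≤ |δ|`, with EMPTY exceptional sets;
* `averageToEvery_of_one_le_abs` — the crux `AverageToEvery` restricted to `1 ≤ |δ|` (its body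
  verbatim under the extra binder `1 ≤ |δ|`), and `averageToEvery_imp_of_one_le_abs` (bookkeeping:
  it IS the restriction of the crux).

Net calibration (with the half-filled file): the every-ground-state upgrade `AverageToEvery` is a
THEOREM, pointwise in the coupling and without any window or genericity, for every
`δ ∈ (-∞, -1] ∪ {0} ∪ [1, ∞)`; it is OPEN exactly on the doped range `0 < |δ| < 1` (containing the
summit's `δ ∈ (0, 1/2)`), where it is the Hubbard-specific spectral-rigidity residual of
`Cruxes/AverageToEvery/PROMOTE-stub_countableAccidentalCouplings.md`. The slices `|δ| ≥ 1` are of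
course physically empty (no or all electrons); they are recorded so that the open range is delimited
by theorems rather than by prose.

Sources: H. Tasaki, *Physics and Mathematics of Quantum Many-Body Systems* (2020) §2.1, §9.2 (Fock
space, particle-number sectors); E. H. Lieb, PRL 62 (1989) 1201 (the `S^z = 0` sector). Folklore
finite-dimensional linear algebra; no definition and no named fact is introduced.
-/

noncomputable section

-- `dupNamespace`: the summit and the problem are both named `HubbardSuperconductivity` (layout D-0022)
set_option linter.dupNamespace false

namespace Summit.HubbardSuperconductivity.HubbardSuperconductivity.Theorems

open Matrix Finset Filter
open Literature.Probability.LatticeModels Literature.MathematicalPhysics.QuantumLattice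
open scoped ComplexOrder Matrix Classical

/-! ## The two templates -/

/-- **Uniqueness up to scalars ⇒ the ground eigenspace has no proper nonzero subspace.** At any
coupling `U`, side `L` and filling `N`: if any two ground states of `hubbardTorus 2 L 1 U` in the
joint sector `(N, S^z = 0)` are proportional, then every subspace `K'` of the sector ground
eigenspace `E₀ = szSector N 0 ⊓ ker (H - e₀)` (`e₀ = minEnergyOn H (szSector N 0)`) is `⊥` or `E₀`
(nonzero members of `E₀` are sector ground states). Tasaki (2020) §2.1. [folklore] -/
theorem botOrTop_of_groundStates_smul (U : ℝ) (L N : ℕ) [NeZero L]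
    (hsmul : ∀ φ φ' : Fock (Orb (FermionTorus 2 L)),
      IsGroundStateInSector (hubbardTorus 2 L 1 U) N 0 φ →
      IsGroundStateInSector (hubbardTorus 2 L 1 U) N 0 φ' → ∃ a : ℂ, φ' = a • φ)
    (K' : Submodule ℂ (Fock (Orb (FermionTorus 2 L))))
    (hK' : K' ≤ szSector N 0 ⊓
        Module.End.eigenspace (Matrix.toLin' (hubbardTorus 2 L 1 U))
          ((((hubbardTorus 2 L 1 U).minEnergyOn (szSector N 0)) : ℝ) : ℂ)) :
    K' = ⊥ ∨
      K' = szSector N 0 ⊓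
        Module.End.eigenspace (Matrix.toLin' (hubbardTorus 2 L 1 U))
          ((((hubbardTorus 2 L 1 U).minEnergyOn (szSector N 0)) : ℝ) : ℂ) := by
  -- nonzero members of the ground eigenspace are sector ground states
  have hgs : ∀ v ∈ szSector N 0 ⊓
        Module.End.eigenspace (Matrix.toLin' (hubbardTorus 2 L 1 U))
          ((((hubbardTorus 2 L 1 U).minEnergyOn (szSector N 0)) : ℝ) : ℂ), v ≠ 0 →
      IsGroundStateInSector (hubbardTorus 2 L 1 U) N 0 v := by
    intro v hv hv0
    obtain ⟨hvS, hvE⟩ := Submodule.mem_inf.mp hv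
    refine ⟨hvS, hv0, ?_⟩
    have h := Module.End.mem_eigenspace_iff.mp hvE
    rwa [Matrix.toLin'_apply] at h
  by_cases hbot : K' = ⊥
  · exact Or.inl hbot
  · right
    obtain ⟨v, hvK, hv0⟩ := (Submodule.ne_bot_iff K').mp hbot
    refine le_antisymm hK' fun w hw => ?_
    by_cases hw0 : w = 0
    · rw [hw0]; exact K'.zero_mem
    · obtain ⟨a, ha⟩ := hsmul v w (hgs v (hK' hvK) hv0) (hgs w hw hw0)
      rw [ha]; exact K'.smul_mem a hvK

/-- **The every-ground-state upgrade at one coupling from eventual uniqueness up to scalars.** Fix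
`U`, `δ`, `c > 0`, `L₀`, `L₁`. If from side `L₁` on (even `L`) any two ground states of
`hubbardTorus 2 L 1 U` in the sector `(2⌊(1-δ)L²/2⌋, S^z = 0)` are proportional, and from side
`L₀` on the tracial ground-state functional of `H` compressed to that occupation block gives the
compressed `Δ_d† Δ_d` a real part `≥ c L⁴` (the crux hypothesis read at the single coupling `U`),
then EVERY admissible normalised sector ground-state sequence at `U` has `d_{x²-y²}` pair-field
long-range order: the block average is carried by one normalised sector ground state
(`stub_blockAverageWitness`), every normalised sector ground state is a phase multiple of it, and
`hasLRO_of_forall_groundState_bound` concludes. Tasaki (2020) §2.1; Scalapino, Phys. Rep. 250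
(1995) 329, §2. [folklore] -/
theorem averageToEvery_pointwise_of_groundStates_smul (U δ c : ℝ) (hc : 0 < c) (L₀ L₁ : ℕ)
    (hsmul : ∀ (L : ℕ) [NeZero L], L₁ ≤ L → Even L → ∀ φ φ' : Fock (Orb (FermionTorus 2 L)),
      IsGroundStateInSector (hubbardTorus 2 L 1 U) (2 * ⌊(1 - δ) * (L : ℝ) ^ 2 / 2⌋₊) 0 φ →
      IsGroundStateInSector (hubbardTorus 2 L 1 U) (2 * ⌊(1 - δ) * (L : ℝ) ^ 2 / 2⌋₊) 0 φ' →
      ∃ a : ℂ, φ' = a • φ)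
    (hyp : ∀ (L : ℕ) [NeZero L], L₀ ≤ L → Even L →
        c * (L : ℝ) ^ 4 ≤ (((hubbardTorus 2 L 1 U).toBlock
          (fun s : Finset (Orb (FermionTorus 2 L)) => s.card = 2 * ⌊(1 - δ) * (L : ℝ) ^ 2 / 2⌋₊ ∧
            2 * (s.filter fun i => (ofLex i).2 = 0).card = 2 * ⌊(1 - δ) * (L : ℝ) ^ 2 / 2⌋₊)
          (fun s : Finset (Orb (FermionTorus 2 L)) => s.card = 2 * ⌊(1 - δ) * (L : ℝ) ^ 2 / 2⌋₊ ∧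
            2 * (s.filter fun i => (ofLex i).2 = 0).card = 2 * ⌊(1 - δ) * (L : ℝ) ^ 2 / 2⌋₊)).groundStateFunctional
          ((((pairField dWaveFormFactor L)ᴴ * pairField dWaveFormFactor L)).toBlock
          (fun s : Finset (Orb (FermionTorus 2 L)) => s.card = 2 * ⌊(1 - δ) * (L : ℝ) ^ 2 / 2⌋₊ ∧
            2 * (s.filter fun i => (ofLex i).2 = 0).card = 2 * ⌊(1 - δ) * (L : ℝ) ^ 2 / 2⌋₊)
          (fun s : Finset (Orb (FermionTorus 2 L)) => s.card = 2 * ⌊(1 - δ) * (L : ℝ) ^ 2 / 2⌋₊ ∧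
            2 * (s.filter fun i => (ofLex i).2 = 0).card = 2 * ⌊(1 - δ) * (L : ℝ) ^ 2 / 2⌋₊))).re)
    (N : ℕ → ℕ) (ψ : ∀ L, Fock (Orb (FermionTorus 2 L)))
    (hadm : ∀ L, Even L → N L = 2 * ⌊(1 - δ) * (L : ℝ) ^ 2 / 2⌋₊ ∧ star (ψ L) ⬝ᵥ ψ L = 1 ∧
      IsGroundStateInSector (hubbardTorus 2 L 1 U) (N L) 0 (ψ L)) :
    HasLongRangeOrder (fun k => halfOpenBox 2 (2 * k))
      (fun k => torusPullback (pairFieldCorr dWaveFormFactor ψ) (2 * k)) := by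
  refine hasLRO_of_forall_groundState_bound U δ c hc (max L₀ L₁) ?_ N ψ hadm
  intro L _ hL hLe φ hgs hunit
  -- one normalised sector ground state carrying the block average (block ↔ Fock dictionary)
  obtain ⟨φ₀, hgs₀, hunit₀, hle₀⟩ :=
    stub_blockAverageWitness U c L ⌊(1 - δ) * (L : ℝ) ^ 2 / 2⌋₊ hc
      (hyp L ((le_max_left _ _).trans hL) hLe)
  -- uniqueness: `φ` is a phase multiple of `φ₀`
  obtain ⟨a, ha⟩ := hsmul L ((le_max_right _ _).trans hL) hLe φ₀ φ hgs₀ hgs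
  have haa : star a * a = 1 := by
    have h := hunit
    rw [ha, star_smul, smul_dotProduct, dotProduct_smul, hunit₀, smul_eq_mul, smul_eq_mul,
      mul_one] at h
    exact h
  have hexp : star φ ⬝ᵥ ((pairField dWaveFormFactor L)ᴴ * pairField dWaveFormFactor L) *ᵥ φ =
      star φ₀ ⬝ᵥ ((pairField dWaveFormFactor L)ᴴ * pairField dWaveFormFactor L) *ᵥ φ₀ := by
    rw [ha, star_smul, Matrix.mulVec_smul, smul_dotProduct, dotProduct_smul, smul_smul, haa,
      one_smul]
  rw [hexp]
  exact hle₀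

/-! ## Uniqueness up to scalars on the slices `|δ| ≥ 1` -/

/-- **`δ ≥ 1`: the sector is the vacuum ray.** For `1 ≤ δ` the filling is
`2⌊(1-δ)L²/2⌋ = 0`, a `0`-particle vector is a multiple of the vacuum indicator `[s = ∅]`, so any
two `(0, S^z = 0)`-sector ground states (indeed any two nonzero sector vectors) are proportional —
at every real coupling and every side. Tasaki (2020) §9.2. [folklore] -/
theorem groundStates_smul_of_one_le {δ : ℝ} (hδ : 1 ≤ δ) (U : ℝ) (L : ℕ) [NeZero L]
    (φ φ' : Fock (Orb (FermionTorus 2 L)))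
    (hφ : IsGroundStateInSector (hubbardTorus 2 L 1 U) (2 * ⌊(1 - δ) * (L : ℝ) ^ 2 / 2⌋₊) 0 φ)
    (hφ' : IsGroundStateInSector (hubbardTorus 2 L 1 U) (2 * ⌊(1 - δ) * (L : ℝ) ^ 2 / 2⌋₊) 0 φ') :
    ∃ a : ℂ, φ' = a • φ := by
  have hfloor : ⌊(1 - δ) * (L : ℝ) ^ 2 / 2⌋₊ = 0 := by
    refine Nat.floor_of_nonpos ?_
    have : (1 - δ) * (L : ℝ) ^ 2 ≤ 0 := mul_nonpos_of_nonpos_of_nonneg (by linarith) (by positivity)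
    linarith
  rw [hfloor, Nat.mul_zero] at hφ hφ'
  -- `0`-particle vectors are supported on `∅`
  have hsupp : ∀ χ : Fock (Orb (FermionTorus 2 L)), IsGroundStateInSector (hubbardTorus 2 L 1 U) 0 0 χ →
      ∀ s : Finset (Orb (FermionTorus 2 L)), s ≠ ∅ → χ s = 0 := by
    intro χ hχ s hs
    have hN := ((mem_szSector_iff _ _ _).1 hχ.1).1
    exact hN s (fun h => hs (Finset.card_eq_zero.mp h))
  have hφ0 : φ ∅ ≠ 0 := by
    intro h0
    refine hφ.2.1 (funext fun s => ?_)
    by_cases hs : s = ∅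
    · rw [hs, h0]; rfl
    · exact hsupp φ hφ s hs
  refine ⟨φ' ∅ / φ ∅, funext fun s => ?_⟩
  by_cases hs : s = ∅
  · rw [hs, Pi.smul_apply, smul_eq_mul, div_mul_cancel₀ _ hφ0]
  · rw [Pi.smul_apply, hsupp φ' hφ' s hs, hsupp φ hφ s hs, smul_zero]

/-- **`δ = -1`: the sector is the fully-occupied ray.** At `δ = -1` the filling is
`2⌊(1-(-1))L²/2⌋ = 2L² = |Orb|`, a `2L²`-particle vector is a multiple of the indicator of the full
occupation set, so any two sector ground states are proportional — at every real coupling and every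
side. Tasaki (2020) §9.2. [folklore] -/
theorem groundStates_smul_neg_one (U : ℝ) (L : ℕ) [NeZero L]
    (φ φ' : Fock (Orb (FermionTorus 2 L)))
    (hφ : IsGroundStateInSector (hubbardTorus 2 L 1 U) (2 * ⌊(1 - (-1)) * (L : ℝ) ^ 2 / 2⌋₊) 0 φ)
    (hφ' : IsGroundStateInSector (hubbardTorus 2 L 1 U) (2 * ⌊(1 - (-1)) * (L : ℝ) ^ 2 / 2⌋₊) 0 φ') :
    ∃ a : ℂ, φ' = a • φ := by
  have hfloor : ⌊(1 - (-1)) * (L : ℝ) ^ 2 / 2⌋₊ = L ^ 2 := by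
    have h : (1 - (-1)) * (L : ℝ) ^ 2 / 2 = ((L ^ 2 : ℕ) : ℝ) := by push_cast; ring
    rw [h, Nat.floor_natCast]
  rw [hfloor] at hφ hφ'
  have hcardU : (Finset.univ : Finset (Orb (FermionTorus 2 L))).card = 2 * L ^ 2 := by
    have hΛ : Fintype.card (FermionTorus 2 L) = L ^ 2 := by
      change Fintype.card (Fin 2 → Fin L) = L ^ 2
      rw [Fintype.card_fun, Fintype.card_fin, Fintype.card_fin]
    rw [Finset.card_univ, card_orb, hΛ]
  -- `2L²`-particle vectors are supported on `univ`
  have hsupp : ∀ χ : Fock (Orb (FermionTorus 2 L)),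
      IsGroundStateInSector (hubbardTorus 2 L 1 U) (2 * L ^ 2) 0 χ →
      ∀ s : Finset (Orb (FermionTorus 2 L)), s ≠ Finset.univ → χ s = 0 := by
    intro χ hχ s hs
    have hN := ((mem_szSector_iff _ _ _).1 hχ.1).1
    refine hN s fun h => hs ?_
    rw [← hcardU] at h
    exact Finset.card_eq_iff_eq_univ _ |>.mp h
  have hφ0 : φ Finset.univ ≠ 0 := by
    intro h0
    refine hφ.2.1 (funext fun s => ?_)
    by_cases hs : s = Finset.univ
    · rw [hs, h0]; rfl
    · exact hsupp φ hφ s hs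
  refine ⟨φ' Finset.univ / φ Finset.univ, funext fun s => ?_⟩
  by_cases hs : s = Finset.univ
  · rw [hs, Pi.smul_apply, smul_eq_mul, div_mul_cancel₀ _ hφ0]
  · rw [Pi.smul_apply, hsupp φ' hφ' s hs, hsupp φ hφ s hs, smul_zero]

/-- **`δ < -1`: no sector ground states from some side on** (`N_L = 2⌊(1-δ)L²/2⌋ > 2L² = |Orb|`,
`not_isGroundStateInSector_of_lt_neg_one`), so uniqueness up to scalars holds vacuously from that
side on, at every real coupling. [folklore] -/
theorem groundStates_smul_of_lt_neg_one {δ : ℝ} (hδ : δ < -1) :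
    ∃ L₁ : ℕ, ∀ (U : ℝ) (L : ℕ) [NeZero L], L₁ ≤ L → Even L →
      ∀ φ φ' : Fock (Orb (FermionTorus 2 L)),
        IsGroundStateInSector (hubbardTorus 2 L 1 U) (2 * ⌊(1 - δ) * (L : ℝ) ^ 2 / 2⌋₊) 0 φ →
        IsGroundStateInSector (hubbardTorus 2 L 1 U) (2 * ⌊(1 - δ) * (L : ℝ) ^ 2 / 2⌋₊) 0 φ' →
        ∃ a : ℂ, φ' = a • φ := by
  obtain ⟨L₁, hL₁⟩ := not_isGroundStateInSector_of_lt_neg_one hδ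
  exact ⟨L₁, fun U L _ hL _ φ _ hφ _ => (hL₁ L hL _ φ hφ).elim⟩

/-- **Eventual uniqueness up to scalars on `|δ| ≥ 1`, at every real coupling** (the three slices
`δ ≥ 1`, `δ = -1`, `δ < -1` combined; the threshold is needed only for `δ < -1`). [folklore] -/
theorem groundStates_smul_of_one_le_abs {δ : ℝ} (hδ : 1 ≤ |δ|) :
    ∃ L₁ : ℕ, ∀ (U : ℝ) (L : ℕ) [NeZero L], L₁ ≤ L → Even L →
      ∀ φ φ' : Fock (Orb (FermionTorus 2 L)),
        IsGroundStateInSector (hubbardTorus 2 L 1 U) (2 * ⌊(1 - δ) * (L : ℝ) ^ 2 / 2⌋₊) 0 φ →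
        IsGroundStateInSector (hubbardTorus 2 L 1 U) (2 * ⌊(1 - δ) * (L : ℝ) ^ 2 / 2⌋₊) 0 φ' →
        ∃ a : ℂ, φ' = a • φ := by
  rcases le_abs'.mp hδ with hneg | hpos
  · -- `δ ≤ -1`
    rcases hneg.lt_or_eq with hlt | heq
    · exact groundStates_smul_of_lt_neg_one hlt
    · subst heq
      exact ⟨0, fun U L _ _ _ φ φ' hφ hφ' => groundStates_smul_neg_one U L φ φ' hφ hφ'⟩
  · -- `1 ≤ δ`
    exact ⟨0, fun U L _ _ _ φ φ' hφ hφ' => groundStates_smul_of_one_le hpos U L φ φ' hφ hφ'⟩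

/-! ## The BET and the crux on `|δ| ≥ 1` -/

/-- **The irreducible-ground law HOLDS on `|δ| ≥ 1`, at every coupling.** For `1 ≤ |δ|` there is a
side `L₁` such that for every real `U` and every even `L ≥ L₁` the sector ground eigenspace
`E₀(U, L) = szSector N_L 0 ⊓ ker (H - e₀)`, `N_L = 2⌊(1-δ)L²/2⌋`, has no subspace other than `⊥` and
itself (`botOrTop_of_groundStates_smul` + `groundStates_smul_of_one_le_abs`). [folklore] -/
theorem irreducibleGround_of_one_le_abs {δ : ℝ} (hδ : 1 ≤ |δ|) :
    ∃ L₁ : ℕ, ∀ (U : ℝ) (L : ℕ) [NeZero L], L₁ ≤ L → Even L →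
      ∀ K' : Submodule ℂ (Fock (Orb (FermionTorus 2 L))),
        K' ≤ szSector (2 * ⌊(1 - δ) * (L : ℝ) ^ 2 / 2⌋₊) 0 ⊓
            Module.End.eigenspace (Matrix.toLin' (hubbardTorus 2 L 1 U))
              ((((hubbardTorus 2 L 1 U).minEnergyOn
                (szSector (2 * ⌊(1 - δ) * (L : ℝ) ^ 2 / 2⌋₊) 0) : ℝ) : ℂ)) →
        K' = ⊥ ∨
          K' = szSector (2 * ⌊(1 - δ) * (L : ℝ) ^ 2 / 2⌋₊) 0 ⊓
            Module.End.eigenspace (Matrix.toLin' (hubbardTorus 2 L 1 U))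
              ((((hubbardTorus 2 L 1 U).minEnergyOn
                (szSector (2 * ⌊(1 - δ) * (L : ℝ) ^ 2 / 2⌋₊) 0) : ℝ) : ℂ)) := by
  obtain ⟨L₁, hL₁⟩ := groundStates_smul_of_one_le_abs hδ
  exact ⟨L₁, fun U L _ hL hLe K' hK' =>
    botOrTop_of_groundStates_smul U L _ (hL₁ U L hL hLe) K' hK'⟩

/-- **The BET of line `birth` restricted to `|δ| ≥ 1`** (`stub_countableAccidentalCouplings` of
`Cruxes/AverageToEvery/Lines/birth.lean`, its body verbatim under the extra binder `1 ≤ |δ|`): with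
EMPTY exceptional sets `B L = ∅` the sector ground eigenspace is irreducible under the joint commutant
of `H`, `N̂`, `S^z`, `Δ_d† Δ_d` for every coupling of the window — regardless of the window
hypothesis — because it has no proper nonzero subspace at all (`irreducibleGround_of_one_le_abs`).
[folklore] -/
theorem stub_countableAccidentalCouplings_of_one_le_abs :
    ∀ δ : ℝ, 1 ≤ |δ| → ∀ (U₁ U₂ c : ℝ) (L₀ : ℕ), 0 < U₁ → U₁ < U₂ → 0 < c →
      (∀ U ∈ Set.Ioo U₁ U₂, ∀ (L : ℕ) [NeZero L], L₀ ≤ L → Even L →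
        c * (L : ℝ) ^ 4 ≤ (((hubbardTorus 2 L 1 U).toBlock
          (fun s : Finset (Orb (FermionTorus 2 L)) => s.card = 2 * ⌊(1 - δ) * (L : ℝ) ^ 2 / 2⌋₊ ∧
            2 * (s.filter fun i => (ofLex i).2 = 0).card = 2 * ⌊(1 - δ) * (L : ℝ) ^ 2 / 2⌋₊)
          (fun s : Finset (Orb (FermionTorus 2 L)) => s.card = 2 * ⌊(1 - δ) * (L : ℝ) ^ 2 / 2⌋₊ ∧
            2 * (s.filter fun i => (ofLex i).2 = 0).card = 2 * ⌊(1 - δ) * (L : ℝ) ^ 2 / 2⌋₊)).groundStateFunctional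
          ((((pairField dWaveFormFactor L)ᴴ * pairField dWaveFormFactor L)).toBlock
          (fun s : Finset (Orb (FermionTorus 2 L)) => s.card = 2 * ⌊(1 - δ) * (L : ℝ) ^ 2 / 2⌋₊ ∧
            2 * (s.filter fun i => (ofLex i).2 = 0).card = 2 * ⌊(1 - δ) * (L : ℝ) ^ 2 / 2⌋₊)
          (fun s : Finset (Orb (FermionTorus 2 L)) => s.card = 2 * ⌊(1 - δ) * (L : ℝ) ^ 2 / 2⌋₊ ∧
            2 * (s.filter fun i => (ofLex i).2 = 0).card = 2 * ⌊(1 - δ) * (L : ℝ) ^ 2 / 2⌋₊))).re) →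
      ∃ L₁ : ℕ, ∃ B : ℕ → Set ℝ, (∀ L, (B L).Countable) ∧
        ∀ (L : ℕ) [NeZero L], L₁ ≤ L → Even L → ∀ U ∈ Set.Ioo U₁ U₂, U ∉ B L →
          ∀ K' : Submodule ℂ (Fock (Orb (FermionTorus 2 L))),
            K' ≤ szSector (2 * ⌊(1 - δ) * (L : ℝ) ^ 2 / 2⌋₊) 0 ⊓
              Module.End.eigenspace (Matrix.toLin' (hubbardTorus 2 L 1 U))
                ((((hubbardTorus 2 L 1 U).minEnergyOn
                  (szSector (2 * ⌊(1 - δ) * (L : ℝ) ^ 2 / 2⌋₊) 0) : ℝ) : ℂ)) →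
            (∀ X : Matrix (Finset (Orb (FermionTorus 2 L))) (Finset (Orb (FermionTorus 2 L))) ℂ,
              X * hubbardTorus 2 L 1 U = hubbardTorus 2 L 1 U * X →
              X * totalNumber = totalNumber * X →
              X * HubbardWave0.spinZ = HubbardWave0.spinZ * X →
              X * ((pairField dWaveFormFactor L)ᴴ * pairField dWaveFormFactor L) =
                (pairField dWaveFormFactor L)ᴴ * pairField dWaveFormFactor L * X →
              ∀ v ∈ K', X *ᵥ v ∈ K') →
            K' = ⊥ ∨
              K' = szSector (2 * ⌊(1 - δ) * (L : ℝ) ^ 2 / 2⌋₊) 0 ⊓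
                Module.End.eigenspace (Matrix.toLin' (hubbardTorus 2 L 1 U))
                  ((((hubbardTorus 2 L 1 U).minEnergyOn
                    (szSector (2 * ⌊(1 - δ) * (L : ℝ) ^ 2 / 2⌋₊) 0) : ℝ) : ℂ)) := by
  intro δ hδ U₁ U₂ _ _ _ _ _ _
  obtain ⟨L₁, hL₁⟩ := irreducibleGround_of_one_le_abs hδ
  refine ⟨L₁, fun _ => ∅, fun _ => Set.countable_empty, ?_⟩
  intro L _ hL hLe U _ _ K' hK' _
  exact hL₁ U L hL hLe K' hK'

/-- **The crux `AverageToEvery` HOLDS on `|δ| ≥ 1`** (its body verbatim under the extra binder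
`1 ≤ |δ|`, window form): at the midpoint of the window (any coupling would do) every admissible
normalised sector ground-state sequence has `d_{x²-y²}` pair-field long-range order, by the pointwise
template `averageToEvery_pointwise_of_groundStates_smul` and `groundStates_smul_of_one_le_abs`.
(Physically empty slices — no or all electrons; recorded to delimit the open doped range
`0 < |δ| < 1` by theorems.) [folklore] -/
theorem averageToEvery_of_one_le_abs :
    ∀ δ : ℝ, 1 ≤ |δ| → ∀ (U₁ U₂ c : ℝ) (L₀ : ℕ), 0 < U₁ → U₁ < U₂ → 0 < c →
      (∀ U ∈ Set.Ioo U₁ U₂, ∀ (L : ℕ) [NeZero L], L₀ ≤ L → Even L →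
        let p : Finset (Orb (FermionTorus 2 L)) → Prop := fun s =>
          s.card = 2 * ⌊(1 - δ) * (L : ℝ) ^ 2 / 2⌋₊ ∧
            2 * (s.filter fun i => (ofLex i).2 = 0).card = 2 * ⌊(1 - δ) * (L : ℝ) ^ 2 / 2⌋₊
        c * (L : ℝ) ^ 4 ≤ (((hubbardTorus 2 L 1 U).toBlock p p).groundStateFunctional
          (((pairField dWaveFormFactor L)ᴴ * pairField dWaveFormFactor L).toBlock p p)).re) →
      ∃ U ∈ Set.Ioo U₁ U₂, ∀ (N : ℕ → ℕ) (ψ : ∀ L, Fock (Orb (FermionTorus 2 L))),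
        (∀ L, Even L → N L = 2 * ⌊(1 - δ) * (L : ℝ) ^ 2 / 2⌋₊ ∧ star (ψ L) ⬝ᵥ ψ L = 1 ∧
          IsGroundStateInSector (hubbardTorus 2 L 1 U) (N L) 0 (ψ L)) →
        HasLongRangeOrder (fun k => halfOpenBox 2 (2 * k))
          (fun k => torusPullback (pairFieldCorr dWaveFormFactor ψ) (2 * k)) := by
  intro δ hδ U₁ U₂ c L₀ hU₁ hU₁₂ hc hyp
  obtain ⟨L₁, hL₁⟩ := groundStates_smul_of_one_le_abs hδ
  refine ⟨(U₁ + U₂) / 2, ⟨by linarith, by linarith⟩, fun N ψ hadm => ?_⟩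
  exact averageToEvery_pointwise_of_groundStates_smul ((U₁ + U₂) / 2) δ c hc L₀ L₁
    (fun L _ hL hLe => hL₁ _ L hL hLe)
    (fun L _ hL hLe => hyp ((U₁ + U₂) / 2) ⟨by linarith, by linarith⟩ L hL hLe) N ψ hadm

/-- **Bookkeeping: `averageToEvery_of_one_le_abs` IS the restriction of the crux to `|δ| ≥ 1`.**
`AverageToEvery` with its leading `∀ δ` guarded by `1 ≤ |δ|` is, word for word, the statement above
(one-term proof; certifies the restriction is typed exactly as the crux). [folklore] -/
theorem averageToEvery_imp_of_one_le_abs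
    (h : Summit.HubbardSuperconductivity.HubbardSuperconductivity.Theses.LogColdTorus.AverageToEvery) :
    ∀ δ : ℝ, 1 ≤ |δ| → ∀ (U₁ U₂ c : ℝ) (L₀ : ℕ), 0 < U₁ → U₁ < U₂ → 0 < c →
      (∀ U ∈ Set.Ioo U₁ U₂, ∀ (L : ℕ) [NeZero L], L₀ ≤ L → Even L →
        let p : Finset (Orb (FermionTorus 2 L)) → Prop := fun s =>
          s.card = 2 * ⌊(1 - δ) * (L : ℝ) ^ 2 / 2⌋₊ ∧
            2 * (s.filter fun i => (ofLex i).2 = 0).card = 2 * ⌊(1 - δ) * (L : ℝ) ^ 2 / 2⌋₊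
        c * (L : ℝ) ^ 4 ≤ (((hubbardTorus 2 L 1 U).toBlock p p).groundStateFunctional
          (((pairField dWaveFormFactor L)ᴴ * pairField dWaveFormFactor L).toBlock p p)).re) →
      ∃ U ∈ Set.Ioo U₁ U₂, ∀ (N : ℕ → ℕ) (ψ : ∀ L, Fock (Orb (FermionTorus 2 L))),
        (∀ L, Even L → N L = 2 * ⌊(1 - δ) * (L : ℝ) ^ 2 / 2⌋₊ ∧ star (ψ L) ⬝ᵥ ψ L = 1 ∧
          IsGroundStateInSector (hubbardTorus 2 L 1 U) (N L) 0 (ψ L)) →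
        HasLongRangeOrder (fun k => halfOpenBox 2 (2 * k))
          (fun k => torusPullback (pairFieldCorr dWaveFormFactor ψ) (2 * k)) :=
  fun δ _ => h δ

end Summit.HubbardSuperconductivity.HubbardSuperconductivity.Theorems

end
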